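import Summits.AtomisticToContinuum.BoseEinsteinCondensation.Theses.BECProbeMassFlow
import Summits.AtomisticToContinuum.BoseEinsteinCondensation.Theorems.BECGroundStateSOSPeriodicIRBoundWFComGap
import Summits.AtomisticToContinuum.BoseEinsteinCondensation.Theorems.BECFeynmanVortexAreaZeroMomentumGround
import Literature.Barriers.AtomisticToContinuum.KineticGapLengthScalesThermodynamicWindow
import HarnessLib

/-!
# Free near-minimisers on the torus sit at zero total momentum — stub `stub_freeZeroMomentum`

Helper file for the crux `BECProbeMassFlow.CloudMomentumAtom` (item
stmt-AtomisticToContinuum-12310), line `registered` (skeleton `Cruxes/CloudMomentumAtom/Lines/birth.lean`):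
the registered stub **`stub_freeZeroMomentum`**, statement verbatim from the checked skeleton.

For every repulsive finite-range `v` and `ε > 0` there is `ρ₀ > 0` such that for `0 < ρ < ρ₀`,
eventually in `N`, there is `δ > 0` such that every `δ`-near-minimiser `Ψ` of the scatterer-FREE
periodic energy of `N` bosons on the torus of side `L = sideLength ρ (N + 1)` has
`L⁶ w₀(Ψ) = ∫⁻_{cell^N} ‖∫_{cell} Ψ(X + t𝟙) dt‖₊² ≥ (1 − ε) L⁶`.

## Proof (no Perron–Frobenius, no compactness: the diamagnetic centre-of-mass floor suffices)

Fix `(N, L)` with `N ≥ 1`, `L > 0` and `E₀ := E^per(N, L) < ⊤` (small density, eventually in `N`,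
hard cores included: `exists_eventually_periodicGroundStateEnergy_lt_top` on the shifted box and the
monotonicity `E^per(N, L) ≤ E^per(N+1, L)`, `WF.periodicGroundStateEnergy_le_succ`).  Write
`P := L⁻³∫_{cell} T_t dt` for the centre-of-mass projection (`WF.comProj`) and `Ψ_q`, `q ∈ ℤ³`, for the
centre-of-mass Fourier components (`WF.comCoeff`; `Ψ_0 = PΨ`, `Ψ_q` has total momentum `2πq/L`).
Parseval in the centre of mass gives Pythagoras `‖Ψ‖² = ‖PΨ‖² + ‖Ψ − PΨ‖²` and
`𝓔[Ψ] = 𝓔[PΨ] + 𝓔[Ψ − PΨ]` (`WF.comProj_pythagoras`), and coefficient by coefficient the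
diamagnetic sector floor `E₀ + |2πq/L|²/N ≤ E^per_N(2πq/L)`
(`ZeroMomentumGround.periodicGroundStateEnergy_add_le_momentumSectorEnergy`, every `v`, every `q`)
together with `|q| ≥ 1` for `q ≠ 0` yields the complement gap
`(E₀ + γ) ‖Ψ − PΨ‖² ≤ 𝓔[Ψ − PΨ]`, `γ := (2π/L)²/N` (`gap_comProj_compl`).  Hence for a normalised
`Ψ` with `𝓔[Ψ] ≤ E₀ + δ`:  `E₀ + γ‖Ψ − PΨ‖² ≤ E₀‖PΨ‖² + (E₀ + γ)‖Ψ − PΨ‖² ≤ 𝓔[Ψ] ≤ E₀ + δ`, so with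
`δ := γ ε` (chosen AFTER `N`; no uniformity in `N`) `‖Ψ − PΨ‖² ≤ ε`, `‖PΨ‖² ≥ 1 − ε`, and
`∫⁻‖∫_{cell} Ψ(X + t𝟙) dt‖₊² = L⁶‖PΨ‖² ≥ (1 − ε)L⁶`.

No new definitions; every declaration is a theorem.
-/

noncomputable section

open MeasureTheory Filter
open scoped ENNReal NNReal ComplexConjugate BigOperators

namespace Summit.AtomisticToContinuum.BoseEinsteinCondensation.Cruxes.CloudMomentumAtom.Birth

open Literature.MathematicalPhysics.QuantumManyBody.BoseGas
open Summit.AtomisticToContinuum.BoseEinsteinCondensation.Cruxes.PeriodicIRBound.LinearPhFloorWagner.WF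
open Summit.AtomisticToContinuum.BoseEinsteinCondensation.Theorems.ZeroMomentumGround
  (periodicGroundStateEnergy_add_le_momentumSectorEnergy)
open Literature.Barriers.AtomisticToContinuum.BoseGas (exists_eventually_periodicGroundStateEnergy_lt_top)

variable {N : ℕ} {L : ℝ}

/-! ### The dual lattice: `|2πq/L| ≥ 2π/L` for `q ≠ 0` -/

/-- A coordinate is bounded by the norm of a dual-lattice vector: `(c q_j)² ≤ ‖latticeVec c q‖²`.
[folklore] -/
theorem sq_coord_le_norm_sq_latticeVec (c : ℝ) (q : Fin 3 → ℤ) (j : Fin 3) :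
    (c * q j) ^ 2 ≤ ‖latticeVec c q‖ ^ 2 := by
  rw [EuclideanSpace.norm_sq_eq]
  have h : ∀ i, ‖latticeVec c q i‖ ^ 2 = (c * q i) ^ 2 := fun i => by
    rw [Real.norm_eq_abs, sq_abs]; rfl
  calc (c * q j) ^ 2 = ‖latticeVec c q j‖ ^ 2 := (h j).symm
    _ ≤ ∑ i, ‖latticeVec c q i‖ ^ 2 :=
        Finset.single_le_sum (f := fun i => ‖latticeVec c q i‖ ^ 2) (fun i _ => by positivity)
          (Finset.mem_univ j)

/-- A non-zero dual-lattice vector is at least as long as the generator: `c² ≤ ‖latticeVec c q‖²`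
for `q ∈ ℤ³ ∖ {0}` (some coordinate `q_j` is a non-zero integer, `q_j² ≥ 1`). [folklore] -/
theorem sq_le_norm_sq_latticeVec (c : ℝ) {q : Fin 3 → ℤ} (hq : q ≠ 0) :
    c ^ 2 ≤ ‖latticeVec c q‖ ^ 2 := by
  obtain ⟨j, hj⟩ := Function.ne_iff.1 hq
  have h1 : (1 : ℝ) ≤ (q j : ℝ) ^ 2 := by
    have h : (1 : ℤ) ≤ q j ^ 2 := by
      have ha := Int.one_le_abs hj
      calc (1 : ℤ) = 1 * 1 := (mul_one 1).symm
        _ ≤ |q j| * |q j| := mul_le_mul ha ha zero_le_one (abs_nonneg _)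
        _ = q j ^ 2 := by rw [← sq, sq_abs]
    exact_mod_cast h
  calc c ^ 2 ≤ c ^ 2 * (q j : ℝ) ^ 2 := le_mul_of_one_le_right (sq_nonneg _) h1
    _ = (c * q j) ^ 2 := by ring
    _ ≤ ‖latticeVec c q‖ ^ 2 := sq_coord_le_norm_sq_latticeVec c q j

/-! ### The gap of the orthogonal complement of the zero-momentum sector -/

/-- **Complement gap from the diamagnetic centre-of-mass floor.** For every `w : ℝ → ℝ≥0∞`
(measurable), `M ≥ 1`, `L > 0` and every core `Ψ` (`C¹`, periodic, Bose-symmetric),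
`(E₀ + (2π/L)²/M) · ‖Ψ − PΨ‖² ≤ 𝓔_w[Ψ − PΨ]`: Parseval in the centre of mass for `Ψ − PΨ` (whose
components are `0, (Ψ_q)_{q ≠ 0}`), the sector variational principle `E_M(2πq/L)‖Ψ_q‖² ≤ 𝓔[Ψ_q]`
and the floor `E₀ + |2πq/L|²/M ≤ E_M(2πq/L)` with `|2πq/L|² ≥ (2π/L)²` for `q ≠ 0`. [folklore] -/
theorem gap_comProj_compl {M : ℕ} (hM : 0 < M) (hL : 0 < L) {w : ℝ → ℝ≥0∞} (hw : Measurable w)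
    {Ψ : Config M → ℂ} (hΨ : IsCore L Ψ) :
    (periodicGroundStateEnergy w M L + ENNReal.ofReal ((2 * Real.pi / L) ^ 2 / M)) *
        normSq L (fun X => Ψ X - comProj L Ψ X) ≤ qform w L (fun X => Ψ X - comProj L Ψ X) := by
  -- the key inequality, coefficient by coefficient
  have hkey : ∀ q : Fin 3 → ℤ, q ≠ 0 →
      periodicGroundStateEnergy w M L + ENNReal.ofReal ((2 * Real.pi / L) ^ 2 / M) ≤
        momentumSectorEnergy w M L (latticeVec (2 * Real.pi / L) q) := by
    intro q hq
    refine le_trans (add_le_add le_rfl (ENNReal.ofReal_le_ofReal ?_))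
      (periodicGroundStateEnergy_add_le_momentumSectorEnergy hM w L _)
    exact div_le_div_of_nonneg_right (sq_le_norm_sq_latticeVec _ hq) (Nat.cast_nonneg M)
  -- Parseval for `Ψ - PΨ` and summation
  have hPc : IsCore L (fun X => Ψ X - comProj L Ψ X) := isCore_sub' hΨ (isCore_comProj hL hΨ).1
  rw [← tsum_normSq_comCoeff hL hPc, ← tsum_qform_comCoeff hL hw hPc, ← ENNReal.tsum_mul_left]
  refine ENNReal.tsum_le_tsum fun q => ?_
  rw [comCoeff_sub_comProj hL hΨ q]
  by_cases hq : q = 0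
  · simp only [hq, if_true, normSq_zero_fun, mul_zero]
    exact bot_le
  · simp only [if_neg hq]
    obtain ⟨hcq, hmq⟩ := isCore_comCoeff hL hΨ q
    exact (mul_le_mul_left (hkey q hq) _).trans (momentumSectorEnergy_mul_normSq_le hL w hcq hmq)

/-! ### The mass of the projection and the crux integrand -/

/-- **Unscaling.** `‖PΨ‖² = L⁻⁶ ∫⁻_{cell^N} ‖∫_{cell} Ψ(X + t𝟙) dt‖₊²` (`PΨ = L⁻³∫_{cell} T_tΨ dt`
pointwise; the constant comes out of the lower integral). [folklore] -/
theorem normSq_comProj_eq (hL : 0 < L) (Ψ : Config N → ℂ) :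
    normSq L (comProj L Ψ) = ENNReal.ofReal ((L ^ 6)⁻¹) *
      ∫⁻ X in cellN N L, (‖∫ t in cell L, Ψ (X + fun _ => t)‖₊ : ℝ≥0∞) ^ 2 := by
  have hc : ((‖(((L ^ 3)⁻¹ : ℝ) : ℂ)‖₊ : ℝ≥0∞)) ^ 2 = ENNReal.ofReal ((L ^ 6)⁻¹) := by
    rw [coe_nnnorm_sq_eq_ofReal, Complex.norm_real, Real.norm_of_nonneg (by positivity), inv_pow,
      ← pow_mul]
  unfold normSq comProj
  simp_rw [nnnorm_mul, ENNReal.coe_mul, mul_pow, hc]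
  rw [lintegral_const_mul' _ _ ENNReal.ofReal_ne_top]
  rfl

/-! ### The fixed-`(N, L)` statement -/

/-- **Free near-minimisers sit at zero total momentum, at fixed `(N, L)`.** If `N ≥ 1`, `L > 0`,
`v` is measurable and `E₀ := E^per(N, L) < ⊤`, then for every `ε > 0`, with
`δ := ((2π/L)²/N) · ε`, every periodic trial state `Ψ` with `⟨Ψ, HΨ⟩ ≤ E₀ + δ` has
`∫⁻_{cell^N} ‖∫_{cell} Ψ(X + t𝟙) dt‖₊² ≥ (1 − ε) L⁶`. [folklore] -/
theorem freeZeroMomentum_fixed (hN : 0 < N) (hL : 0 < L) {v : ℝ → ℝ≥0∞} (hv : Measurable v)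
    (hE : periodicGroundStateEnergy v N L ≠ ⊤) {ε : ℝ} (hε : 0 < ε) :
    ∃ δ : ℝ≥0∞, 0 < δ ∧
      ∀ Ψ : PeriodicTrialState N L,
        periodicEnergy v Ψ ≤ periodicGroundStateEnergy v N L + δ →
        ENNReal.ofReal ((1 - ε) * L ^ 6) ≤
          ∫⁻ X in cellN N L, (‖∫ t in cell L, Ψ.ψ (X + fun _ => t)‖₊ : ℝ≥0∞) ^ 2 := by
  have hNpos : (0 : ℝ) < N := by exact_mod_cast hN
  set E₀ : ℝ≥0∞ := periodicGroundStateEnergy v N L with hE₀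
  set γ : ℝ≥0∞ := ENNReal.ofReal ((2 * Real.pi / L) ^ 2 / N) with hγ
  have hγ0 : γ ≠ 0 := (ENNReal.ofReal_pos.2 (by positivity)).ne'
  have hγtop : γ ≠ ⊤ := ENNReal.ofReal_ne_top
  refine ⟨γ * ENNReal.ofReal ε, ENNReal.mul_pos hγ0 (ENNReal.ofReal_pos.2 hε).ne', fun Ψ hΨ => ?_⟩
  have hf : IsCore L Ψ.ψ := isCore_trialState Ψ
  have h1 : normSq L Ψ.ψ = 1 := Ψ.norm_eq
  obtain ⟨hPyN, hPyQ⟩ := comProj_pythagoras hL hv hf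
  -- the zero-momentum part and its complement
  have hP : E₀ * normSq L (comProj L Ψ.ψ) ≤ qform v L (comProj L Ψ.ψ) :=
    PeriodicIRBound.LinearPhFloorWagner.WF.groundStateEnergy_mul_normSq_le hL hv
      (isCore_comProj hL hf).1
  have hR := gap_comProj_compl hN hL hv hf
  rw [← hγ, ← hE₀] at hR
  -- summation: `E₀ + γ‖Ψ - PΨ‖² ≤ ⟨Ψ, HΨ⟩ ≤ E₀ + γ ε`
  have hsum : E₀ + γ * normSq L (fun X => Ψ.ψ X - comProj L Ψ.ψ X) ≤ E₀ + γ * ENNReal.ofReal ε :=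
    calc E₀ + γ * normSq L (fun X => Ψ.ψ X - comProj L Ψ.ψ X)
        = E₀ * normSq L (comProj L Ψ.ψ) +
            (E₀ + γ) * normSq L (fun X => Ψ.ψ X - comProj L Ψ.ψ X) := by
          rw [add_mul, ← add_assoc, ← mul_add, ← hPyN, h1, mul_one]
      _ ≤ qform v L (comProj L Ψ.ψ) + qform v L (fun X => Ψ.ψ X - comProj L Ψ.ψ X) :=
          add_le_add hP hR
      _ = periodicEnergy v Ψ := by rw [periodicEnergy_eq_qform, hPyQ]
      _ ≤ E₀ + γ * ENNReal.ofReal ε := hΨ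
  have hRε : normSq L (fun X => Ψ.ψ X - comProj L Ψ.ψ X) ≤ ENNReal.ofReal ε :=
    (ENNReal.mul_le_mul_iff_right hγ0 hγtop).1 (ENNReal.le_of_add_le_add_left hE hsum)
  -- hence `‖PΨ‖² ≥ 1 - ε`
  have hP' : ENNReal.ofReal (1 - ε) ≤ normSq L (comProj L Ψ.ψ) := by
    rw [ENNReal.ofReal_sub _ hε.le, ENNReal.ofReal_one]
    refine tsub_le_iff_right.2 ?_
    calc (1 : ℝ≥0∞) = normSq L Ψ.ψ := h1.symm
      _ = normSq L (comProj L Ψ.ψ) + normSq L (fun X => Ψ.ψ X - comProj L Ψ.ψ X) := hPyN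
      _ ≤ normSq L (comProj L Ψ.ψ) + ENNReal.ofReal ε := add_le_add le_rfl hRε
  -- unscale
  have hL6 : (0 : ℝ) < L ^ 6 := by positivity
  calc ENNReal.ofReal ((1 - ε) * L ^ 6) = ENNReal.ofReal (L ^ 6) * ENNReal.ofReal (1 - ε) := by
        rw [mul_comm, ENNReal.ofReal_mul hL6.le]
    _ ≤ ENNReal.ofReal (L ^ 6) * normSq L (comProj L Ψ.ψ) := mul_le_mul_right hP' _
    _ = ∫⁻ X in cellN N L, (‖∫ t in cell L, Ψ.ψ (X + fun _ => t)‖₊ : ℝ≥0∞) ^ 2 := by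
        rw [normSq_comProj_eq hL, ← mul_assoc, ← ENNReal.ofReal_mul hL6.le,
          mul_inv_cancel₀ hL6.ne', ENNReal.ofReal_one, one_mul]

/-! ### The registered stub -/

/-- **Stub 2 `stub_freeZeroMomentum` — free near-minimisers sit at zero total momentum** (statement
verbatim from the checked skeleton of the line `registered` of crux `CloudMomentumAtom`).
For every repulsive finite-range `v` and `ε > 0` there is `ρ₀ > 0` such that for `0 < ρ < ρ₀`,
eventually in `N`, there is `δ > 0` such that every `δ`-near-minimiser `Ψ` of the scatterer-FREE
periodic energy of `N` bosons on the torus of side `L = sideLength ρ (N + 1)` has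
`L⁶ w₀(Ψ) = ∫⁻_{cell^N} ‖∫_{cell} Ψ(X + t𝟙) dt‖₊² ≥ (1 − ε) L⁶`.
Proof: `ρ₀ := ρ₁` of `exists_eventually_periodicGroundStateEnergy_lt_top` (finite torus energies at
small density, hard cores included), shifted to the box of `N + 1` particles and transported to `N`
particles by `E^per(N, L) ≤ E^per(N+1, L)`; then `freeZeroMomentum_fixed` at fixed `(N, L)` with
`δ := ((2π/L)²/N) ε` chosen after `N`. [folklore] -/
theorem stub_freeZeroMomentum :
    ∀ (v : ℝ → ℝ≥0∞), IsRepulsiveFiniteRange v → ∀ ε : ℝ, 0 < ε →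
      ∃ ρ₀ : ℝ, 0 < ρ₀ ∧ ∀ ρ : ℝ, 0 < ρ → ρ < ρ₀ → ∀ᶠ N : ℕ in atTop,
        ∀ L : ℝ, L = sideLength ρ (N + 1) →
          ∃ δ : ℝ≥0∞, 0 < δ ∧
            ∀ Ψ : PeriodicTrialState N L,
              periodicEnergy v Ψ ≤ periodicGroundStateEnergy v N L + δ →
              ENNReal.ofReal ((1 - ε) * L ^ 6) ≤
                ∫⁻ X in cellN N L, (‖∫ t in cell L, Ψ.ψ (X + fun _ => t)‖₊ : ℝ≥0∞) ^ 2 := by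
  intro v hv ε hε
  obtain ⟨ρ₁, hρ₁, hfin⟩ := exists_eventually_periodicGroundStateEnergy_lt_top hv
  refine ⟨ρ₁, hρ₁, fun ρ hρ hρρ₁ => ?_⟩
  have hev : ∀ᶠ N : ℕ in atTop,
      periodicGroundStateEnergy v (N + 1) (sideLength ρ (N + 1)) < ⊤ :=
    (tendsto_add_atTop_nat 1).eventually (hfin ρ hρ hρρ₁)
  filter_upwards [hev, eventually_gt_atTop 0] with N hN1 hN
  intro L hL
  have hLpos : 0 < L := by
    rw [hL]
    unfold sideLength
    exact Real.rpow_pos_of_pos (div_pos (by positivity) hρ) _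
  have hE : periodicGroundStateEnergy v N L ≠ ⊤ := by
    refine ((periodicGroundStateEnergy_le_succ hLpos hv.1 N).trans_lt ?_).ne
    rw [hL]
    exact hN1
  exact freeZeroMomentum_fixed hN hLpos hv.1 hE hε

end Summit.AtomisticToContinuum.BoseEinsteinCondensation.Cruxes.CloudMomentumAtom.Birth

end
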